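import Mathlib.Analysis.Analytic.Uniqueness
import Mathlib.Analysis.Analytic.OfScalars
import Mathlib.Analysis.Calculus.InverseFunctionTheorem.FDeriv
import Mathlib.Analysis.SpecialFunctions.Exponential
import Literature.Analysis.Calculus.ExpDifferentialGSeries
import Literature.Analysis.Complex.LogOnePlus

/-!
# `g(−z)⁻¹ = log(1 + w)/w` at `w = e^{z} − 1`: the generating function of Dynkin's formula, on a Banach algebra

statement-level skeleton of published theorems with citation tags; proofs where landed; nothing here is a claim about the Yang–Mills mass gap

Topic `Analysis/Calculus`; namespace `Literature.Analysis.Calculus.ExpDifferential` (the grouping sub-namespace of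
`ExpDifferentialGSeries` / `ExpDifferentialAdSeries`: the differential `D exp_X = e^X g(ad X)` of the exponential map of a
Banach algebra, `g(z) = (1 − e^{−z})/z`, [Balaban1985Averaging] (32)–(34), [Varadarajan1984] (2.15.7)–(2.15.10)).

This file supplies the one analytic identity through which the INVERSE `h = 1/g` of [Varadarajan1984] (2.15.10)
(`g(ad X)⁻¹`, Bałaban's `g⁻¹(±ad)` of (34)/(36)) is expressed by the LOGARITHMIC series — the step behind the explicit
Baker–Campbell–Hausdorff–Dynkin formula [Balaban1985Averaging] (29) (= [Varadarajan1984] Ch. 2, Exercise 44 (d)):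
for an element `T` of a complex Banach algebra `𝔹` with `‖T‖ < log 2`,

  `g(−T) · Λ(e^{T} − 1) = 1`,   `Λ(W) := Σ_{k≥0} ((−1)^k/(k+1)) W^k`  («`log(1 + W)/W`»),

i.e. `g⁻¹(−T) = Λ(e^T − 1)` and `g⁻¹(T) = Λ(e^T − 1) e^{T}` (`gInv_neg_eq_logQuot`, `gInv_eq_logQuot_mul_exp`): in the
functional calculus of [Varadarajan1984] Lemma 2.15.1 this is the scalar identity `((e^z − 1)/z)·(z/(e^z − 1)) = 1` read at
`w = e^z − 1`, `log(1 + w) = z`.  Mathlib has no holomorphic functional calculus with composition for a general Banach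
algebra, so the identity is PROVED here by an identity-theorem device that may be of independent use
(`eqOn_zero_ball_of_mul_arg_eventually_eq_zero`): **if `f : 𝔹 → 𝔹` is analytic on a ball around `0` and `f(T)·T = 0`
for all `T` near `0`, then `f = 0` on the ball** (restrict `f` to the complex line `μ ↦ T₀ + μ·1`; on an annulus
`‖T₀‖ < |μ| < R` the element `T₀ + μ·1` is invertible, so `f` vanishes there, hence on the disc, hence at `T₀`; then
continue analytically).  The hypothesis `f(T)·T = 0` near `0` comes from `Λ(W)·W = log(1+W)`, `g(−T)·T = e^T − 1` and
`log(e^T) = T` NEAR `0` (`eventually_logOnePlus_exp_sub_one`, from the inverse function theorem for `exp` at `0`).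

Everything is `sorry`-free and Mathlib-only apart from the two imported tree files (`gSer`/`gInv`, `logOnePlus`).

## References

* [Varadarajan1984] V. S. Varadarajan, *Lie Groups, Lie Algebras, and Their Representations*, GTM 102 (1984), §2.15:
  Lemma 2.15.1 (functional calculus `φ ↦ φ(L)`, `φ(L)⁻¹ = (1/φ)(L)`), (2.15.7)–(2.15.10) (`g`, `h = 1/g`), Ch. 2 Exercise
  44 (d) (Dynkin's formula, «`C = log(1 + u)`, `u = Σ_{p+q≥1} U^pV^q/p!q!`»).
* [Balaban1985Averaging] T. Bałaban, CMP **98** (1985) 17–51, (29) p. 22, (32)–(34) pp. 22–23.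
* [Hall2015] B. C. Hall, *Lie Groups, Lie Algebras, and Representations*, 2nd ed., GTM 222, §5.5 (the function
  `ψ(z) = z log z/(z − 1) = Λ(z − 1)·z` of the integral form of BCH).
-/

noncomputable section

open NormedSpace Filter Metric Set FormalMultilinearSeries
open Literature.Analysis.Complex
open scoped Topology Nat

namespace Literature.Analysis.Calculus.ExpDifferential

variable {𝔹 : Type*} [NormedRing 𝔹] [NormedAlgebra ℂ 𝔹] [CompleteSpace 𝔹]

/-! ### §1. Scalar power series with coefficients of modulus `≤ 1` are analytic on the unit ball -/

omit [CompleteSpace 𝔹] in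
/-- A scalar power series `Σ cₙ xⁿ` with `|cₙ| ≤ 1` has radius of convergence `≥ 1` on any normed `ℂ`-algebra
(no hypothesis on `‖1‖`). [cite: Varadarajan1984, Lemma 2.15.1] -/
theorem one_le_radius_ofScalars_of_norm_le_one {c : ℕ → ℂ} (hc : ∀ n, ‖c n‖ ≤ 1) :
    (1 : ENNReal) ≤ (ofScalars 𝔹 c).radius := by
  refine ENNReal.le_of_forall_nnreal_lt fun r hr => ?_
  refine (ofScalars 𝔹 c).le_radius_of_bound (max 1 ‖ofScalars 𝔹 c 0‖) fun n => ?_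
  have hr1 : (r : ℝ) ≤ 1 := by exact_mod_cast hr.le
  rcases Nat.eq_zero_or_pos n with rfl | hn
  · simp
  · calc ‖ofScalars 𝔹 c n‖ * (r : ℝ) ^ n ≤ 1 * 1 ^ n := by
          gcongr
          · exact (ofScalars_norm_le 𝔹 c n hn).trans (hc n)
      _ ≤ max 1 ‖ofScalars 𝔹 c 0‖ := by simp

/-- … hence its sum `x ↦ Σ cₙ xⁿ` is analytic at every point of the open unit ball («`φ(L) = Σ aₙ(φ)Lⁿ` is absolutely
convergent … for `|L| < a`»). [cite: Varadarajan1984, Lemma 2.15.1] -/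
theorem analyticAt_ofScalarsSum_of_norm_le_one {c : ℕ → ℂ} (hc : ∀ n, ‖c n‖ ≤ 1) {x : 𝔹} (hx : ‖x‖ < 1) :
    AnalyticAt ℂ (ofScalarsSum (E := 𝔹) c) x := by
  have h1 := one_le_radius_ofScalars_of_norm_le_one (𝔹 := 𝔹) hc
  have h := (ofScalars 𝔹 c).hasFPowerSeriesOnBall (lt_of_lt_of_le zero_lt_one h1)
  refine h.analyticAt_of_mem ?_
  refine Metric.mem_eball.2 (lt_of_lt_of_le ?_ h1)
  rw [edist_zero_right, ← ofReal_norm]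
  exact_mod_cast ENNReal.ofReal_lt_one.2 hx

omit [NormedAlgebra ℂ 𝔹] [CompleteSpace 𝔹] in
/-- `‖W^k‖ ≤ max(‖1‖, 1) · ‖W‖^k` (the case `k = 0` is `‖1‖`; no `NormOneClass` needed). [folklore] -/
private theorem norm_pow_le_max_mul (W : 𝔹) (k : ℕ) : ‖W ^ k‖ ≤ max ‖(1 : 𝔹)‖ 1 * ‖W‖ ^ k := by
  rcases Nat.eq_zero_or_pos k with rfl | hk
  · simp
  · calc ‖W ^ k‖ ≤ ‖W‖ ^ k := norm_pow_le' W hk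
      _ ≤ max ‖(1 : 𝔹)‖ 1 * ‖W‖ ^ k := le_mul_of_one_le_left (by positivity) (le_max_right _ _)

/-! ### §2. The series `Λ(W) = Σ_{k≥0} (−1)^k W^k/(k+1)` («`log(1+W)/W`») and `g(−T) = Σ Tⁿ/(n+1)!` -/

/-- `Λ(W) = Σ_{k≥0} ((−1)^k/(k+1)) W^k`, the power series of `log(1 + w)/w` evaluated at an element of a Banach algebra
(coefficients `logSeriesCoeff (k+1) = (−1)^k/(k+1)` of the tree's logarithmic series `logOnePlus`).  It is the outer
generating function of Dynkin's formula: `Σ_{m≥1} ((−1)^{m+1}/m) u^{m−1} = Λ(u)` («`C = log(1 + u)`»).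
[cite: Varadarajan1984, Ch. 2 Exercise 44 (d)] -/
def logQuot (W : 𝔹) : 𝔹 := ∑' k : ℕ, logSeriesCoeff (k + 1) • W ^ k

omit [CompleteSpace 𝔹] in
/-- `Λ` is the sum of the scalar power series with coefficients `(−1)^k/(k+1)`. [cite: Varadarajan1984, Ch. 2 Exercise 44 (d)] -/
theorem logQuot_eq_ofScalarsSum : (logQuot : 𝔹 → 𝔹) = ofScalarsSum fun k => logSeriesCoeff (k + 1) := by
  rw [ofScalarsSum_eq_tsum]; rfl

omit [CompleteSpace 𝔹] in
/-- The terms of `Λ(W)` are dominated by `max(‖1‖,1)‖W‖^k`. [cite: Varadarajan1984, Lemma 2.15.1] -/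
theorem norm_logQuot_term_le (W : 𝔹) (k : ℕ) :
    ‖logSeriesCoeff (k + 1) • W ^ k‖ ≤ max ‖(1 : 𝔹)‖ 1 * ‖W‖ ^ k := by
  refine (norm_smul_le _ _).trans ?_
  calc ‖logSeriesCoeff (k + 1)‖ * ‖W ^ k‖ ≤ 1 * ‖W ^ k‖ :=
        mul_le_mul_of_nonneg_right (norm_logSeriesCoeff_le _) (norm_nonneg _)
    _ ≤ max ‖(1 : 𝔹)‖ 1 * ‖W‖ ^ k := by rw [one_mul]; exact norm_pow_le_max_mul W k

omit [CompleteSpace 𝔹] in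
/-- The series `Λ(W)` converges absolutely for `‖W‖ < 1`. [cite: Varadarajan1984, Lemma 2.15.1] -/
theorem summable_norm_logQuot_term {W : 𝔹} (hW : ‖W‖ < 1) :
    Summable fun k : ℕ => ‖logSeriesCoeff (k + 1) • W ^ k‖ :=
  Summable.of_nonneg_of_le (fun _ => norm_nonneg _) (norm_logQuot_term_le W)
    ((summable_geometric_of_lt_one (norm_nonneg W) hW).mul_left _)

/-- `HasSum` form of the definition of `Λ(W)`, `‖W‖ < 1`. [cite: Varadarajan1984, Lemma 2.15.1] -/
theorem hasSum_logQuot {W : 𝔹} (hW : ‖W‖ < 1) :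
    HasSum (fun k : ℕ => logSeriesCoeff (k + 1) • W ^ k) (logQuot W) :=
  (summable_norm_logQuot_term hW).of_norm.hasSum

omit [CompleteSpace 𝔹] in
/-- `Λ(0) = 1`. [cite: Varadarajan1984, Ch. 2 Exercise 44 (d)] -/
@[simp] theorem logQuot_zero : logQuot (0 : 𝔹) = 1 := by
  rw [logQuot, tsum_eq_single 0]
  · simp [logSeriesCoeff]
  · intro k hk
    simp [zero_pow hk]

/-- **`Λ(W)·W = log(1 + W)`** for `‖W‖ < 1` (the defining property of the quotient series).
[cite: Varadarajan1984, Ch. 2 Exercise 44 (d)] -/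
theorem logQuot_mul_self {W : 𝔹} (hW : ‖W‖ < 1) : logQuot W * W = logOnePlus W := by
  have h1 : HasSum (fun k : ℕ => (logSeriesCoeff (k + 1) • W ^ k) * W) (logQuot W * W) :=
    (hasSum_logQuot hW).mul_right W
  have h2 : HasSum (fun k : ℕ => logSeriesCoeff (k + 1) • W ^ (k + 1)) (logOnePlus W) := by
    have h := (hasSum_nat_add_iff' (f := fun n : ℕ => logSeriesCoeff n • W ^ n) 1).mpr (hasSum_logOnePlus hW)
    simp only [Finset.sum_range_one, logSeriesCoeff_zero, zero_smul, sub_zero] at h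
    exact h
  have h3 : (fun k : ℕ => (logSeriesCoeff (k + 1) • W ^ k) * W) = fun k => logSeriesCoeff (k + 1) • W ^ (k + 1) := by
    funext k; rw [smul_mul_assoc, ← pow_succ]
  rw [h3] at h1
  exact h1.unique h2

/-- `W·Λ(W) = log(1 + W)` for `‖W‖ < 1`. [cite: Varadarajan1984, Ch. 2 Exercise 44 (d)] -/
theorem self_mul_logQuot {W : 𝔹} (hW : ‖W‖ < 1) : W * logQuot W = logOnePlus W := by
  have h1 : HasSum (fun k : ℕ => W * (logSeriesCoeff (k + 1) • W ^ k)) (W * logQuot W) :=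
    (hasSum_logQuot hW).mul_left W
  have h2 : HasSum (fun k : ℕ => logSeriesCoeff (k + 1) • W ^ (k + 1)) (logOnePlus W) := by
    have h := (hasSum_nat_add_iff' (f := fun n : ℕ => logSeriesCoeff n • W ^ n) 1).mpr (hasSum_logOnePlus hW)
    simp only [Finset.sum_range_one, logSeriesCoeff_zero, zero_smul, sub_zero] at h
    exact h
  have h3 : (fun k : ℕ => W * (logSeriesCoeff (k + 1) • W ^ k)) = fun k => logSeriesCoeff (k + 1) • W ^ (k + 1) := by
    funext k; rw [mul_smul_comm, ← pow_succ']
  rw [h3] at h1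
  exact h1.unique h2

omit [CompleteSpace 𝔹] in
/-- Whatever commutes with `W` commutes with `Λ(W)`. [cite: Varadarajan1984, Lemma 2.15.1] -/
theorem commute_logQuot {T W : 𝔹} (h : Commute T W) : Commute T (logQuot W) :=
  Commute.tsum_right _ fun k => (h.pow_right k).smul_right _

/-- `Λ` is analytic at every `W` with `‖W‖ < 1`. [cite: Varadarajan1984, Lemma 2.15.1] -/
theorem analyticAt_logQuot {W : 𝔹} (hW : ‖W‖ < 1) : AnalyticAt ℂ (logQuot : 𝔹 → 𝔹) W := by
  rw [logQuot_eq_ofScalarsSum]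
  exact analyticAt_ofScalarsSum_of_norm_le_one (fun k => norm_logSeriesCoeff_le (k + 1)) hW

omit [CompleteSpace 𝔹] in
/-- `g(−T) = Σ_{n≥0} Tⁿ/(n+1)!` («`(e^{z} − 1)/z`»). [cite: Varadarajan1984, (2.15.7)] -/
theorem gSer_neg_eq_tsum (T : 𝔹) : gSer ℂ (-T) = ∑' n : ℕ, ((n + 1)!⁻¹ : ℂ) • T ^ n := by
  rw [gSer]; simp only [neg_neg]

omit [CompleteSpace 𝔹] in
/-- `T ↦ g(−T)` is the sum of the scalar power series with coefficients `1/(n+1)!`. [cite: Varadarajan1984, (2.15.7)] -/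
theorem gSer_neg_eq_ofScalarsSum : (fun T : 𝔹 => gSer ℂ (-T)) = ofScalarsSum fun n => ((n + 1)!⁻¹ : ℂ) := by
  rw [ofScalarsSum_eq_tsum]; funext T; exact gSer_neg_eq_tsum T

/-- `T ↦ g(−T)` is analytic at every `T` with `‖T‖ < 1` (it is entire; the unit ball is all that is used).
[cite: Varadarajan1984, (2.15.7)] -/
theorem analyticAt_gSer_neg {T : 𝔹} (hT : ‖T‖ < 1) : AnalyticAt ℂ (fun T : 𝔹 => gSer ℂ (-T)) T := by
  rw [gSer_neg_eq_ofScalarsSum]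
  refine analyticAt_ofScalarsSum_of_norm_le_one (fun n => ?_) hT
  rw [norm_inv, Complex.norm_natCast]
  exact inv_le_one_of_one_le₀ (by exact_mod_cast Nat.one_le_iff_ne_zero.mpr (Nat.factorial_ne_zero _))

/-- `g(−T)·T = e^{T} − 1` ((2.15.7) `g(z) = (1 − e^{−z})/z` at `−z`, as an identity in the algebra).
[cite: Varadarajan1984, (2.15.7)] -/
theorem gSer_neg_mul_self (T : 𝔹) : gSer ℂ (-T) * T = exp T - 1 := by
  have h := gSer_mul (𝕂 := ℂ) (-T)
  rw [neg_neg, mul_neg] at h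
  rw [neg_eq_iff_eq_neg.mp h, neg_sub]

omit [CompleteSpace 𝔹] in
/-- Whatever commutes with `S` commutes with `g(S)`. [cite: Varadarajan1984, Lemma 2.15.1] -/
theorem commute_gSer {S X : 𝔹} (h : Commute S X) : Commute (gSer ℂ S) X :=
  Commute.tsum_left _ fun n => ((h.neg_left).pow_left n).smul_left _

/-! ### §3. `log(e^{T}) = T` near `0` (inverse function theorem for `exp` at `0`) -/

/-- The exponential series past its constant term, in norm: `‖e^{T} − 1‖ ≤ e^{‖T‖} − 1` (no hypothesis on `‖1‖`).
[cite: Varadarajan1984, (2.15.7)] -/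
theorem norm_exp_sub_one_le_exp_norm_sub_one (T : 𝔹) : ‖exp T - 1‖ ≤ Real.exp ‖T‖ - 1 := by
  have he : HasSum (fun n : ℕ => ((n + 1)!⁻¹ : ℂ) • T ^ (n + 1)) (exp T - 1) := by
    have := (hasSum_nat_add_iff' 1).mpr (exp_series_hasSum_exp' (𝕂 := ℂ) T)
    simpa using this
  have hr : HasSum (fun n : ℕ => ‖T‖ ^ (n + 1) / (n + 1)!) (Real.exp ‖T‖ - 1) := by
    have h : HasSum (fun n : ℕ => ‖T‖ ^ n / n !) (Real.exp ‖T‖) := by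
      rw [Real.exp_eq_exp_ℝ]
      exact expSeries_div_hasSum_exp ‖T‖
    have := (hasSum_nat_add_iff' 1).mpr h
    simpa using this
  rw [← he.tsum_eq]
  refine tsum_of_norm_bounded hr fun n => ?_
  rw [norm_smul, norm_inv, Complex.norm_natCast, div_eq_inv_mul]
  exact mul_le_mul_of_nonneg_left (norm_pow_le' T (Nat.succ_pos n)) (by positivity)

/-- `‖e^{T} − 1‖ < 1` once `‖T‖ < log 2` — the domain on which `Λ(e^T − 1)` is given by its series.
[cite: Varadarajan1984, Lemma 2.15.1] -/
theorem norm_exp_sub_one_lt_one {T : 𝔹} (hT : ‖T‖ < Real.log 2) : ‖exp T - 1‖ < 1 := by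
  have h1 := norm_exp_sub_one_le_exp_norm_sub_one T
  have h2 : Real.exp ‖T‖ < 2 := by
    calc Real.exp ‖T‖ < Real.exp (Real.log 2) := Real.exp_lt_exp.2 hT
      _ = 2 := Real.exp_log two_pos
  linarith

/-- **`log(e^{T}) = T` for all `T` near `0`**, `log` = the series `logOnePlus (· − 1)`: the exponential map of a Banach
algebra is injective near `0` (inverse function theorem, `(d exp)₀ = 1`), and `exp (log e^{T}) = e^{T}` (`exp ∘ log = id`).
[cite: Varadarajan1984, §2.15 («the exponential map is an analytic diffeomorphism around 0»)] -/
theorem eventually_logOnePlus_exp_sub_one : ∀ᶠ T in 𝓝 (0 : 𝔹), logOnePlus (exp T - 1) = T := by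
  have hexp : HasStrictFDerivAt (exp : 𝔹 → 𝔹)
      ((ContinuousLinearEquiv.refl ℂ 𝔹 : 𝔹 ≃L[ℂ] 𝔹) : 𝔹 →L[ℂ] 𝔹) 0 := by
    rw [ContinuousLinearEquiv.coe_refl, ← ContinuousLinearMap.one_def]
    exact hasStrictFDerivAt_exp_zero
  have h1 : ∀ᶠ x in 𝓝 (0 : 𝔹), hexp.localInverse exp _ 0 (exp x) = x := hexp.eventually_left_inverse
  have hexpc : ContinuousAt (fun T : 𝔹 => exp T - 1) 0 :=
    ((exp_analytic (𝕂 := ℂ) (0 : 𝔹)).continuousAt).sub continuousAt_const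
  have hA : Tendsto (fun T : 𝔹 => logOnePlus (exp T - 1)) (𝓝 0) (𝓝 0) := by
    have h3 : AnalyticAt ℂ (logOnePlus : 𝔹 → 𝔹) (exp (0 : 𝔹) - 1) := by
      apply analyticAt_logOnePlus; simp
    have hc : ContinuousAt (fun T : 𝔹 => logOnePlus (exp T - 1)) 0 :=
      h3.continuousAt.comp_of_eq hexpc rfl
    simpa [ContinuousAt, exp_zero] using hc
  have h2 : ∀ᶠ T in 𝓝 (0 : 𝔹),
      hexp.localInverse exp _ 0 (exp (logOnePlus (exp T - 1))) = logOnePlus (exp T - 1) := hA.eventually h1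
  have h3 : ∀ᶠ T in 𝓝 (0 : 𝔹), ‖exp T - 1‖ < 1 := by
    have hc : Tendsto (fun T : 𝔹 => ‖exp T - 1‖) (𝓝 0) (𝓝 ‖exp (0 : 𝔹) - 1‖) := hexpc.norm.tendsto
    refine hc.eventually_lt_const ?_
    simp
  filter_upwards [h1, h2, h3] with T hT1 hT2 hT3
  rw [exp_logOnePlus_sub_one hT3, hT1] at hT2
  exact hT2.symm

/-! ### §4. The identity-theorem device: `f` analytic, `f(T)·T = 0` near `0` ⇒ `f = 0` -/

/-- **If `f : 𝔹 → 𝔹` is analytic on the ball `‖T‖ < r` and `f(T)·T = 0` for all `T` near `0`, then `f ≡ 0` on the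
ball.**  (Restrict `f` to the complex line `μ ↦ T₀ + μ·1`: for `‖T₀‖ < |μ|` small, `T₀ + μ·1 = μ(1 + μ⁻¹T₀)` is
invertible, so `f` vanishes on an annulus of that line, hence — identity theorem on the disc — at `μ = 0`; this gives
`f = 0` near `0`, and the identity theorem on the ball concludes.)  This is the substitute, in a Banach algebra
without functional calculus, for «if `φ` does not vanish then `φ(L)` is invertible and `φ(L)⁻¹ = (1/φ)(L)`».
[cite: Varadarajan1984, Lemma 2.15.1] -/
theorem eqOn_zero_ball_of_mul_arg_eventually_eq_zero {f : 𝔹 → 𝔹} {r : ℝ}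
    (hf : AnalyticOnNhd ℂ f (ball 0 r)) (h0 : ∀ᶠ T in 𝓝 (0 : 𝔹), f T * T = 0) :
    EqOn f 0 (ball 0 r) := by
  rcases le_or_gt r 0 with hr | hr
  · rw [Metric.ball_eq_empty.2 hr]; exact fun _ h => h.elim
  obtain ⟨ε, hε, hεf⟩ := Metric.eventually_nhds_iff.1 h0
  set δ := min ε r with hδ
  have hδpos : 0 < δ := lt_min hε hr
  set c : ℝ := ‖(1 : 𝔹)‖ with hc
  have hc0 : 0 ≤ c := norm_nonneg _
  -- Claim A: `f T₀ = 0` for `‖T₀‖ (c + 2) < δ`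
  have claimA : ∀ T₀ : 𝔹, ‖T₀‖ * (c + 2) < δ → f T₀ = 0 := by
    intro T₀ hT₀
    have hT₀nn := norm_nonneg T₀
    set R₁ : ℝ := (δ - ‖T₀‖) / (c + 1) with hR₁
    have hT₀δ : ‖T₀‖ < δ := by nlinarith
    have hR₁pos : 0 < R₁ := div_pos (by linarith) (by linarith)
    have hTR : ‖T₀‖ < R₁ := by
      rw [hR₁, lt_div_iff₀ (by linarith)]; nlinarith
    -- points of the complex line through `T₀`
    have hmem : ∀ μ : ℂ, ‖μ‖ < R₁ → ‖T₀ + μ • (1 : 𝔹)‖ < δ := by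
      intro μ hμ
      calc ‖T₀ + μ • (1 : 𝔹)‖ ≤ ‖T₀‖ + ‖μ • (1 : 𝔹)‖ := norm_add_le _ _
        _ = ‖T₀‖ + ‖μ‖ * c := by rw [norm_smul]
        _ < ‖T₀‖ + R₁ * (c + 1) := by nlinarith [mul_nonneg (sub_nonneg.2 hμ.le) hc0, norm_nonneg μ]
        _ = δ := by rw [hR₁]; field_simp; ring
    set fl : ℂ → 𝔹 := fun μ => f (T₀ + μ • (1 : 𝔹)) with hfl
    have hflan : AnalyticOnNhd ℂ fl (ball (0 : ℂ) R₁) := by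
      intro μ hμ
      have hμ' : ‖μ‖ < R₁ := mem_ball_zero_iff.1 hμ
      have haff : AnalyticAt ℂ (fun μ : ℂ => T₀ + μ • (1 : 𝔹)) μ :=
        analyticAt_const.add (analyticAt_id.smul analyticAt_const)
      have hball : T₀ + μ • (1 : 𝔹) ∈ ball (0 : 𝔹) r :=
        mem_ball_zero_iff.2 ((hmem μ hμ').trans_le (min_le_right _ _))
      exact (hf _ hball).comp_of_eq haff rfl
    -- `fl` vanishes on the annulus `‖T₀‖ < |μ| < R₁`
    have hann : ∀ μ : ℂ, ‖T₀‖ < ‖μ‖ → ‖μ‖ < R₁ → fl μ = 0 := by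
      intro μ hμ1 hμ2
      have hμpos : 0 < ‖μ‖ := hT₀nn.trans_lt hμ1
      have hμ0 : μ ≠ 0 := norm_pos_iff.1 hμpos
      have hS0 : f (T₀ + μ • (1 : 𝔹)) * (T₀ + μ • (1 : 𝔹)) = 0 :=
        hεf (by rw [dist_zero_right]; exact (hmem μ hμ2).trans_le (min_le_left _ _))
      have hV : ‖(1 + μ⁻¹ • T₀) - 1‖ < 1 := by
        rw [add_sub_cancel_left, norm_smul, norm_inv, inv_mul_lt_iff₀ hμpos]; linarith
      obtain ⟨u, hu⟩ := isUnit_of_norm_sub_one_lt_one' hV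
      have hS : T₀ + μ • (1 : 𝔹) = μ • (u : 𝔹) := by
        rw [hu, smul_add, smul_smul, mul_inv_cancel₀ hμ0, one_smul, add_comm]
      have h1 : μ • (f (T₀ + μ • (1 : 𝔹)) * (u : 𝔹)) = 0 := by
        rw [← mul_smul_comm, ← hS]; exact hS0
      have h2 : f (T₀ + μ • (1 : 𝔹)) * (u : 𝔹) = 0 := (smul_eq_zero.1 h1).resolve_left hμ0
      calc fl μ = f (T₀ + μ • (1 : 𝔹)) * (u : 𝔹) * (↑u⁻¹ : 𝔹) := by
            rw [mul_assoc, Units.mul_inv, mul_one]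
        _ = 0 := by rw [h2, zero_mul]
    -- identity theorem on the disc `|μ| < R₁`
    set μ₀ : ℂ := (((‖T₀‖ + R₁) / 2 : ℝ) : ℂ) with hμ₀
    have hμ₀norm : ‖μ₀‖ = (‖T₀‖ + R₁) / 2 := by
      rw [hμ₀, Complex.norm_real, Real.norm_eq_abs, abs_of_nonneg (by positivity)]
    have hμ₀1 : ‖T₀‖ < ‖μ₀‖ := by rw [hμ₀norm]; linarith
    have hμ₀2 : ‖μ₀‖ < R₁ := by rw [hμ₀norm]; linarith
    have hev : fl =ᶠ[𝓝 μ₀] 0 := by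
      have hopen : IsOpen {μ : ℂ | ‖T₀‖ < ‖μ‖ ∧ ‖μ‖ < R₁} :=
        (isOpen_lt continuous_const continuous_norm).inter (isOpen_lt continuous_norm continuous_const)
      filter_upwards [hopen.mem_nhds ⟨hμ₀1, hμ₀2⟩] with μ hμ
      exact hann μ hμ.1 hμ.2
    have hzero := hflan.eqOn_zero_of_preconnected_of_eventuallyEq_zero (convex_ball (0 : ℂ) R₁).isPreconnected
      (mem_ball_zero_iff.2 hμ₀2) hev
    have h00 := hzero (mem_ball_self hR₁pos)
    simpa [hfl] using h00
  -- Claim B: `f = 0` near `0`, then analytic continuation on the ball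
  have hB : f =ᶠ[𝓝 (0 : 𝔹)] 0 := by
    have hopen : IsOpen {T : 𝔹 | ‖T‖ * (c + 2) < δ} :=
      isOpen_lt (continuous_norm.mul continuous_const) continuous_const
    filter_upwards [hopen.mem_nhds (show (0 : 𝔹) ∈ {T : 𝔹 | ‖T‖ * (c + 2) < δ} by simp [hδpos])] with T hT
    exact claimA T hT
  exact hf.eqOn_zero_of_preconnected_of_eventuallyEq_zero (convex_ball (0 : 𝔹) r).isPreconnected
    (mem_ball_self hr) hB

/-! ### §5. `g(−T) Λ(e^{T} − 1) = 1` and the inverse `g⁻¹` in terms of `Λ` -/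

/-- **`g(−T)·Λ(e^{T} − 1) = 1` for `‖T‖ < log 2`** — the scalar identity `((e^z − 1)/z)·(log(1+w)/w) = 1` at
`w = e^z − 1` (`log(1+w) = z`), as an identity in any complex Banach algebra: both factors are analytic in `T` on the ball
`‖T‖ < log 2` (where `‖e^T − 1‖ < 1`), their product minus `1` kills `T` near `0` (`Λ(W)W = log(1+W)`,
`g(−T)T = e^T − 1 = W`, `log e^T = T` near `0`), so §4 applies. [cite: Varadarajan1984, Lemma 2.15.1, (2.15.10)] -/
theorem gSer_neg_mul_logQuot_exp_sub_one {T : 𝔹} (hT : ‖T‖ < Real.log 2) :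
    gSer ℂ (-T) * logQuot (exp T - 1) = 1 := by
  have hlog2 : Real.log 2 < 1 := by linarith [Real.log_two_lt_d9]
  set f : 𝔹 → 𝔹 := fun T => gSer ℂ (-T) * logQuot (exp T - 1) - 1 with hf
  have hfan : AnalyticOnNhd ℂ f (ball 0 (Real.log 2)) := by
    intro S hS
    have hS' : ‖S‖ < Real.log 2 := mem_ball_zero_iff.1 hS
    have h1 : AnalyticAt ℂ (fun T : 𝔹 => gSer ℂ (-T)) S := analyticAt_gSer_neg (hS'.trans hlog2)
    have h2 : AnalyticAt ℂ (fun T : 𝔹 => exp T - 1) S := (exp_analytic (𝕂 := ℂ) S).sub analyticAt_const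
    have h3 : AnalyticAt ℂ (logQuot : 𝔹 → 𝔹) (exp S - 1) := analyticAt_logQuot (norm_exp_sub_one_lt_one hS')
    exact (h1.mul (h3.comp_of_eq h2 rfl)).sub analyticAt_const
  have hsmall : ∀ᶠ T in 𝓝 (0 : 𝔹), ‖T‖ < Real.log 2 := by
    have : Tendsto (fun T : 𝔹 => ‖T‖) (𝓝 0) (𝓝 ‖(0 : 𝔹)‖) := continuous_norm.continuousAt.tendsto
    exact this.eventually_lt_const (by simpa using Real.log_pos one_lt_two)
  have h0 : ∀ᶠ T in 𝓝 (0 : 𝔹), f T * T = 0 := by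
    filter_upwards [eventually_logOnePlus_exp_sub_one, hsmall] with T hlog hTlt
    have hW : ‖exp T - 1‖ < 1 := norm_exp_sub_one_lt_one hTlt
    have hc : Commute T (logQuot (exp T - 1)) :=
      commute_logQuot (((Commute.refl T).exp_right).sub_right (Commute.one_right T))
    calc f T * T = gSer ℂ (-T) * (logQuot (exp T - 1) * T) - T := by
          rw [hf, sub_mul, one_mul, mul_assoc]
      _ = gSer ℂ (-T) * T * logQuot (exp T - 1) - T := by rw [← hc.eq, mul_assoc]
      _ = (exp T - 1) * logQuot (exp T - 1) - T := by rw [gSer_neg_mul_self]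
      _ = 0 := by rw [self_mul_logQuot hW, hlog, sub_self]
  have h := eqOn_zero_ball_of_mul_arg_eventually_eq_zero hfan h0 (mem_ball_zero_iff.2 hT)
  simpa [hf, sub_eq_zero] using h

/-- `Λ(e^{T} − 1)·g(−T) = 1` as well (the factors commute). [cite: Varadarajan1984, Lemma 2.15.1, (2.15.10)] -/
theorem logQuot_exp_sub_one_mul_gSer_neg {T : 𝔹} (hT : ‖T‖ < Real.log 2) :
    logQuot (exp T - 1) * gSer ℂ (-T) = 1 := by
  have hc : Commute (gSer ℂ (-T)) (logQuot (exp T - 1)) :=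
    commute_gSer (commute_logQuot (((Commute.refl T).exp_right).sub_right (Commute.one_right T))).neg_left
  rw [← hc.eq, gSer_neg_mul_logQuot_exp_sub_one hT]

/-- **`g⁻¹(−T) = Λ(e^{T} − 1)`** for `‖T‖ < log 2`: the inverse `h(−z) = g(−z)⁻¹ = z/(e^z − 1)` of (2.15.10), Bałaban's
`g⁻¹(−·)` of (34)/(36)–(37), IS the series `Σ_k ((−1)^k/(k+1))(e^{T} − 1)^k`. [cite: Varadarajan1984, (2.15.10)] -/
theorem gInv_neg_eq_logQuot {T : 𝔹} (hT : ‖T‖ < Real.log 2) : gInv ℂ (-T) = logQuot (exp T - 1) := by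
  have hT1 : ‖-T‖ ≤ 1 := by rw [norm_neg]; linarith [Real.log_two_lt_d9]
  obtain ⟨u, hu⟩ := isUnit_gSer (𝕂 := ℂ) hT1
  rw [gInv, ← hu, Ring.inverse_unit]
  exact Units.inv_eq_of_mul_eq_one_right (by rw [hu]; exact gSer_neg_mul_logQuot_exp_sub_one hT)

/-- `g(T)·Λ(e^{T} − 1) = e^{−T}` for `‖T‖ < log 2` (multiply §5's identity by `e^{−T}` and use `e^{T}g(T) = g(−T)`).
[cite: Varadarajan1984, (2.15.10)] -/
theorem gSer_mul_logQuot_exp_sub_one {T : 𝔹} (hT : ‖T‖ < Real.log 2) :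
    gSer ℂ T * logQuot (exp T - 1) = exp (-T) := by
  have h2 : gSer ℂ T = exp (-T) * gSer ℂ (-T) := by
    rw [← exp_mul_gSer (𝕂 := ℂ) T, ← mul_assoc, exp_neg_mul_exp_eq_one (𝕂 := ℂ), one_mul]
  rw [h2, mul_assoc, gSer_neg_mul_logQuot_exp_sub_one hT, mul_one]

/-- `g(T)·(Λ(e^{T} − 1) e^{T}) = 1` for `‖T‖ < log 2`. [cite: Varadarajan1984, (2.15.10)] -/
theorem gSer_mul_logQuot_exp_sub_one_mul_exp {T : 𝔹} (hT : ‖T‖ < Real.log 2) :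
    gSer ℂ T * (logQuot (exp T - 1) * exp T) = 1 := by
  rw [← mul_assoc, gSer_mul_logQuot_exp_sub_one hT, exp_neg_mul_exp_eq_one (𝕂 := ℂ)]

/-- **`g⁻¹(T) = Λ(e^{T} − 1)·e^{T}`** for `‖T‖ < log 2` — `h(z) = g(z)⁻¹ = z e^{z}/(e^{z} − 1)` of (2.15.10), i.e.
Hall's `ψ(e^{z})` with `ψ(u) = u log u/(u − 1)`, as the logarithmic series times `e^{T}`. [cite: Varadarajan1984, (2.15.10)] -/
theorem gInv_eq_logQuot_mul_exp {T : 𝔹} (hT : ‖T‖ < Real.log 2) : gInv ℂ T = logQuot (exp T - 1) * exp T := by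
  have hT1 : ‖T‖ ≤ 1 := by linarith [Real.log_two_lt_d9]
  obtain ⟨u, hu⟩ := isUnit_gSer (𝕂 := ℂ) hT1
  rw [gInv, ← hu, Ring.inverse_unit]
  exact Units.inv_eq_of_mul_eq_one_right (by rw [hu]; exact gSer_mul_logQuot_exp_sub_one_mul_exp hT)

end Literature.Analysis.Calculus.ExpDifferential
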